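import Summits.ABC.IUTFork.Repair.RHReqsideWeightLawsSignRatio
import HarnessLib

/-!
# D-0122 AXIS B, knob k1 — THE TYPED FORM, part 3d: the SHARP `κ = 3/2` bound `15·T_{κ=3/2} ≤ 7·T_print` at every place whose print-unlicensed
# labels are `≥ 4` (REDUCES-STRONGLY as a theorem there), via a ratio transfer that needs the termwise law inequality only on UNLICENSED labels;
# pooling from place-wise conclusions

abc-iut cell, rung LADDER-ABC:A2.RESCUE.H; seat abc-iut-reqb-typ-1 (GEN 3; D-0122 axis B typer k1/k4; R69 (A1) «self-propelled hardening queue»); owner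
abc-iut-rh-lead g3/g4 (`plan/rescue/R-H/ROUND3/REQB-SPEC.md` v0.2 §6(a)(P4) T-words); table of record `REQB-TABLE.tsv` v1 b8ac679ede5d795b (row S-k1-kappa3/2:
`Tmod/T_pooled` 0.0185 | 0.0096, word REDUCES-STRONGLY); parts 3a–3c = p516945 `…Sign` / p517864 `…SignDatum` / p519304 `…SignRatio` (this seat), parts 1/2 =
p506542 / p508156. Nothing re-typed.

WHY. Part 3c's `row_kappaThreeHalves_ratio` gives `T_{3/2} ≤ (2/3)·T_print` everywhere (REDUCES a theorem) because the termwise ratio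
`(⌈j^{3/2}⌉ − 1)/(j² − 1)` is `2/3` at `j = 2` (`5/8` at `j = 3`); from `j = 4` on it is `≤ 7/15 < 1/2`. The transfer only ever uses the termwise inequality on
labels UNLICENSED under print, so wherever print licenses labels `1, 2, 3` the sharp constant applies — and it does at most places of the bed.
* §1 `offDemand_ratio_le_of_unlicensed`: part 3c's transfer with the termwise hypothesis `a(f(j) − den) ≤ b(g(j) − den′)` required ONLY on labels with
  `¬ Cell g` (the others contribute `0 ≤ 0`); `datumOff_le_of_placewise`: pooling from place-wise conclusions `a·T_f(w) ≤ b·T_g(w)` (`w ∈ s`, weights `≥ 0`)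
  to `a·den·T_f(datum) ≤ b·den′·T_g(datum)`.
* §2 `fifteen_mul_lawPow_three_sub_one_le`: **`15(⌈j^{3/2}⌉ − 1) ≤ 7(j² − 1)` for `j ≥ 4`** (certificates `⌈4^{3/2}⌉ ≤ 8`, `⌈5^{3/2}⌉ ≤ 12`, `⌈6^{3/2}⌉ ≤ 15`;
  for `j ≥ 7` the integer `s = ⌊(7j² + 8)/15⌋` has `j³ ≤ s²` since `15s ≥ 7j² − 6` and `(7j² − 6)² ≥ 225j³`; no root evaluated).
* §3 **`row_kappaThreeHalves_ratio_sharp`: if every print-unlicensed label of the place in `{1..L}` is `≥ 4`, then `15·T_{κ=3/2}(w) ≤ 7·T_print(w)`**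
  (`≤ 7/15 < 1/2`: REDUCES-STRONGLY a theorem at the place wherever `T_print > 0`); floor-free sufficient form `row_kappaThreeHalves_ratio_sharp_of_linear`:
  `8m ≤ 3δ + 4(r_in − r_out)` (with `r_out ≤ r_in`) licenses labels `1, 2, 3` under print (part 1 `cell_of_linear`); pooled over any datum all of
  whose places qualify: `datum_kappaThreeHalves_ratio_sharp`. Worked place FREY `p = 7`, `l = 107`: print licenses `1 … 31`, `T_{3/2} = 0` — instance.
CENSUS (this seat, in-seat python over gen 0's extract `P00_places_w.tsv` 5fd034e18b91fa58 of ENGINE A f639208a46862e5e; COMPUTED ≠ PROVED, quoted for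
orientation only): places whose print-unlicensed labels are all `≥ 4`: FREY133 951/1014 · HEX79 505/509 · Q2+DH2 8/8 (= 1464/1531; the floor-free form fires at
934 · 503 · 8); data all of whose places qualify: 98/133 · 75/79 · 4/4; per datum with `T_print > 0`, `T_{3/2} ≤ ½·T_print` holds at 121/125 FREY133 and 44/44
HEX79 data (max datum ratio 0.625 = 5/8, a place with print-unlicensed label `3`). The same script reproduces the table's `Tmod/T_pooled` column from `Cell` /
`offDemand` for all seven k1 singles on both beds (`κ=1` 0.0002 | 0.0000 · affine ½ 0.0951 | 0.0413 · shift 1 1.2250 | 1.1988 · shift 2 1.4575 | 1.3939 ·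
affine 2 3.4554 | 3.0693 · `κ=5/2` 16.9066 | 32.1817 exactly; `κ=3/2` 0.0182 | 0.0096 vs 0.0185 | 0.0096 — the FREY133 difference is the 89-place `R_in`
tie-reading effect recorded by abc-iut-reqb-ref-1 g3 08:35:56Z, same places, per-law scenario choice).
HONEST FRAMING: integer/real arithmetic about OUR typed cell with a free pilot law (a PARAMETER — REQB-SPEC FRAMING; CONSISTENCY with IUT I–III is
abc-iut-reqb-rf-1's column); tier L0 only; the census numerals are computed, not proved; nothing here asserts that abc is proved or refuted, or that
[IUTchIII] Cor. 3.12 / [IUTchIV] Thm. 1.10 holds or fails at any datum, or takes a side on any author; typed ≠ proved; computed ≠ proved.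
[claim: Mochizuki2012, status: disputed] for every IUT locution. [cite: Mochizuki2012, IUTchIII Cor. 3.12 p. 173–174; IUTchIV Prop. 1.4 p. 13, Thm. 1.10 Step (v) p. 27–29]
-/

noncomputable section

open Finset

namespace Summit.ABC.IUTFork.Repair.RH.ReqsideWeightLaws

/-! ## §1. Transfer on unlicensed labels only; pooling from place-wise conclusions -/

open Classical in
/-- **RATIO TRANSFER ON UNLICENSED LABELS.** As part 3c's `offDemand_ratio_le`, but the termwise inequality `a(f(j) − den) ≤ b(g(j) − den′)` is required
only on the labels `1 ≤ j ≤ L` that are NOT `g`-cells (licensed labels contribute `0` on both sides). [folklore] -/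
theorem offDemand_ratio_le_of_unlicensed {f g : ℕ → ℤ} {den den' e m δ rin rout a b : ℤ} (hden : 0 < den) (hden' : 0 < den') (he : 0 < e)
    (hm : 0 ≤ m) (hb : 0 ≤ b) {L : ℕ} (hg' : ∀ j, 1 ≤ j → j ≤ L → den' ≤ g j) (hfg : ∀ j, 1 ≤ j → j ≤ L → f j * den' ≤ g j * den)
    (hab : ∀ j, 1 ≤ j → j ≤ L → ¬ Cell g den' e m δ rin rout j → a * (f j - den) ≤ b * (g j - den')) :
    a * offDemand f den e m δ rin rout L ≤ b * offDemand g den' e m δ rin rout L := by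
  unfold offDemand
  rw [Finset.mul_sum, Finset.mul_sum]
  refine Finset.sum_le_sum fun i hi => ?_
  rw [Finset.mem_range] at hi
  have hiL : i + 1 ≤ L := by omega
  have h3 := hg' (i + 1) (Nat.succ_pos i) hiL
  have h2 := hfg (i + 1) (Nat.succ_pos i) hiL
  by_cases hg : Cell g den' e m δ rin rout (i + 1)
  · rw [if_pos hg, if_pos (cell_of_mul_le_of_cell hden hden' he hm h2 hg), mul_zero, mul_zero]
  · rw [if_neg hg]
    split_ifs
    · rw [mul_zero]; exact mul_nonneg hb (by linarith)
    · exact hab (i + 1) (Nat.succ_pos i) hiL hg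

section Datum

variable {ι : Type*} {s : Finset ι} {e m δ rin rout : ι → ℤ} {q : ι → ℝ}

/-- **POOLING FROM PLACE-WISE CONCLUSIONS** (nats): if `a·T_f(w) ≤ b·T_g(w)` in label units at every place `w ∈ s` and the weights are `≥ 0`, then
`a·den·T_f(datum) ≤ b·den′·T_g(datum)` (`datumOff` divides by each law's denominator). [folklore] -/
theorem datumOff_le_of_placewise {f g : ℕ → ℤ} {den den' a b : ℤ} (hden : 0 < den) (hden' : 0 < den') (hq : ∀ w ∈ s, 0 ≤ q w) {L : ℕ}
    (h : ∀ w ∈ s, a * offDemand f den (e w) (m w) (δ w) (rin w) (rout w) L ≤ b * offDemand g den' (e w) (m w) (δ w) (rin w) (rout w) L) :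
    (a : ℝ) * den * datumOff f den s e m δ rin rout q L ≤ (b : ℝ) * den' * datumOff g den' s e m δ rin rout q L := by
  unfold datumOff
  rw [Finset.mul_sum, Finset.mul_sum]
  refine Finset.sum_le_sum fun w hw => ?_
  have hd : (den : ℝ) ≠ 0 := by exact_mod_cast hden.ne'
  have hd' : (den' : ℝ) ≠ 0 := by exact_mod_cast hden'.ne'
  have h' : (a : ℝ) * (offDemand f den (e w) (m w) (δ w) (rin w) (rout w) L : ℝ) ≤
      (b : ℝ) * (offDemand g den' (e w) (m w) (δ w) (rin w) (rout w) L : ℝ) := by exact_mod_cast h w hw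
  have e1 : (a : ℝ) * den * (((offDemand f den (e w) (m w) (δ w) (rin w) (rout w) L : ℤ) : ℝ) / den * q w) =
      (a : ℝ) * (offDemand f den (e w) (m w) (δ w) (rin w) (rout w) L : ℝ) * q w := by
    field_simp
  have e2 : (b : ℝ) * den' * (((offDemand g den' (e w) (m w) (δ w) (rin w) (rout w) L : ℤ) : ℝ) / den' * q w) =
      (b : ℝ) * (offDemand g den' (e w) (m w) (δ w) (rin w) (rout w) L : ℝ) * q w := by
    field_simp
  rw [e1, e2]
  exact mul_le_mul_of_nonneg_right h' (hq w hw)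

end Datum

/-! ## §2. The sharp law inequality from label `4` on -/

/-- **`15(⌈j^{3/2}⌉ − 1) ≤ 7(j² − 1)` for `j ≥ 4`** (termwise ratio `≤ 7/15`). Certificates: `4³ ≤ 8²`, `5³ ≤ 12²`, `6³ ≤ 15²`; for `j ≥ 7`,
`s = ⌊(7j²+8)/15⌋` satisfies `15s ≥ 7j² − 6 ≥ 0` and `(7j² − 6)² ≥ 225j³` (as `49j − 225 ≥ 118`), so `j³ ≤ s²` and `⌈j^{3/2}⌉ ≤ s ≤ (7j²+8)/15`. [folklore] -/
theorem fifteen_mul_lawPow_three_sub_one_le {j : ℕ} (hj : 4 ≤ j) : 15 * (lawPow 3 j - 1) ≤ 7 * ((j : ℤ) ^ 2 - 1) := by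
  rcases Nat.lt_or_ge j 7 with h | h
  · interval_cases j
    · have hc : lawPow 3 4 ≤ (8 : ℕ) := lawPow_le_of_pow_le_sq (by norm_num)
      push_cast at hc ⊢; linarith
    · have hc : lawPow 3 5 ≤ (12 : ℕ) := lawPow_le_of_pow_le_sq (by norm_num)
      push_cast at hc ⊢; linarith
    · have hc : lawPow 3 6 ≤ (15 : ℕ) := lawPow_le_of_pow_le_sq (by norm_num)
      push_cast at hc ⊢; linarith
  · set s : ℕ := (7 * j ^ 2 + 8) / 15 with hs
    have hdm := Nat.div_add_mod (7 * j ^ 2 + 8) 15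
    have hml : (7 * j ^ 2 + 8) % 15 < 15 := Nat.mod_lt _ (by norm_num)
    have hs1 : 7 * j ^ 2 ≤ 15 * s + 6 := by omega
    have hs2 : 15 * s ≤ 7 * j ^ 2 + 8 := by omega
    have hj7 : (7 : ℤ) ≤ j := by exact_mod_cast h
    have hs1' : 7 * (j : ℤ) ^ 2 ≤ 15 * (s : ℤ) + 6 := by exact_mod_cast hs1
    have hs2' : 15 * (s : ℤ) ≤ 7 * (j : ℤ) ^ 2 + 8 := by exact_mod_cast hs2
    have hcube : (j : ℤ) ^ 3 ≤ (s : ℤ) ^ 2 := by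
      have hA : (0 : ℤ) ≤ 7 * (j : ℤ) ^ 2 - 6 := by nlinarith
      have hB : (7 * (j : ℤ) ^ 2 - 6) ^ 2 ≤ (15 * (s : ℤ)) ^ 2 := by nlinarith
      have hC : 225 * (j : ℤ) ^ 3 ≤ (7 * (j : ℤ) ^ 2 - 6) ^ 2 := by
        have hj3 : (0 : ℤ) ≤ (j : ℤ) ^ 3 := by positivity
        have hj2 : (0 : ℤ) ≤ (j : ℤ) ^ 2 := by positivity
        nlinarith [mul_nonneg hj3 (by linarith : (0 : ℤ) ≤ 49 * (j : ℤ) - 225 - 118),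
          mul_nonneg hj2 (by linarith : (0 : ℤ) ≤ 118 * (j : ℤ) - 84)]
      nlinarith
    have hcube' : j ^ 3 ≤ s ^ 2 := by exact_mod_cast hcube
    have hle : lawPow 3 j ≤ (s : ℕ) := lawPow_le_of_pow_le_sq hcube'
    linarith

/-! ## §3. The sharp `κ = 3/2` row -/

section Rows

variable {e m : ℤ} (he : 0 < e) (hm : 0 ≤ m) (δ rin rout : ℤ) (L : ℕ)
include he hm

/-- **ROW S-k1-kappa3/2, SHARP: `15·T_{κ=3/2}(w) ≤ 7·T_print(w)` at every place whose print-UNLICENSED labels in `{1..L}` are all `≥ 4`** —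
`T_mod/T ≤ 7/15 < 1/2` there: REDUCES-STRONGLY is a THEOREM at such a place wherever `T_print > 0` (census above: 1464/1531 bed places qualify).
[folklore] -/
theorem row_kappaThreeHalves_ratio_sharp
    (h4 : ∀ j, 1 ≤ j → j ≤ L → ¬ Cell (fun j => (j : ℤ) ^ 2) 1 e m δ rin rout j → 4 ≤ j) :
    15 * offDemand (lawPow 3) 1 e m δ rin rout L ≤ 7 * offDemand (fun j => (j : ℤ) ^ 2) 1 e m δ rin rout L :=
  offDemand_ratio_le_of_unlicensed one_pos one_pos he hm (by norm_num)
    (fun j hj _ => by have h1 : (1 : ℤ) ≤ j := (by exact_mod_cast hj); nlinarith)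
    (fun j hj _ => by simpa using (lawPow_three_bracket hj).2)
    (fun j hj hjL hnc => fifteen_mul_lawPow_three_sub_one_le (h4 j hj hjL hnc))

/-- **FLOOR-FREE SUFFICIENT FORM**: `8m ≤ 3δ + 4(r_in − r_out)` (with `r_out ≤ r_in`, `m ≥ 0`) licenses labels `1, 2, 3` under print (part 1
`cell_of_linear`: `(j² − 1)m ≤ jδ + (j+1)G` at `j = 1, 2, 3`), hence `15·T_{κ=3/2}(w) ≤ 7·T_print(w)` (census: fires at 934 | 503 | 8 bed places). [folklore] -/
theorem row_kappaThreeHalves_ratio_sharp_of_linear (hG : rout ≤ rin) (h8 : 8 * m ≤ 3 * δ + 4 * (rin - rout)) :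
    15 * offDemand (lawPow 3) 1 e m δ rin rout L ≤ 7 * offDemand (fun j => (j : ℤ) ^ 2) 1 e m δ rin rout L := by
  refine row_kappaThreeHalves_ratio_sharp he hm δ rin rout L fun j hj _ hnc => ?_
  by_contra hlt
  apply hnc
  refine cell_of_linear one_pos he ?_
  have hj' : (1 : ℤ) ≤ j := by exact_mod_cast hj
  have hj3 : (j : ℤ) ≤ 3 := by exact_mod_cast (by omega : j ≤ 3)
  -- `(j² − 1)m ≤ jδ + (j+1)G` for `1 ≤ j ≤ 3` from `8m ≤ 3δ + 4G` (so `3δ ≥ 8m − 4G`) and `m, G ≥ 0`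
  have hG0 : (0 : ℤ) ≤ rin - rout := by linarith
  nlinarith [mul_nonneg (by linarith : (0 : ℤ) ≤ 3 - (j : ℤ)) hm, mul_nonneg (by linarith : (0 : ℤ) ≤ 3 - (j : ℤ)) hG0,
    mul_nonneg (by linarith : (0 : ℤ) ≤ (j : ℤ) - 1) hm, mul_nonneg (by linarith : (0 : ℤ) ≤ (j : ℤ) - 1) hG0,
    mul_nonneg (by linarith : (0 : ℤ) ≤ 3 - (j : ℤ)) (by linarith : (0 : ℤ) ≤ (j : ℤ) - 1)]

end Rows

section Datum

variable {ι : Type*} {s : Finset ι} {e m δ rin rout : ι → ℤ} {q : ι → ℝ}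

/-- **THE SHARP ROW, POOLED**: on a datum all of whose places have `e_w > 0`, `m_w ≥ 0`, weights `q_w ≥ 0` and print-unlicensed labels `≥ 4`,
`15·T_{κ=3/2}(datum) ≤ 7·T_print(datum)` (nats) — REDUCES-STRONGLY at the datum as a theorem (census: 98/133 FREY133, 75/79 HEX79, 4/4 Q/DH data
qualify at every place; per-datum `≤ ½` holds at 121/125 + 44/44 data with `T_print > 0`, computed). [folklore] -/
theorem datum_kappaThreeHalves_ratio_sharp (he : ∀ w ∈ s, 0 < e w) (hm : ∀ w ∈ s, 0 ≤ m w) (hq : ∀ w ∈ s, 0 ≤ q w) {L : ℕ}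
    (h4 : ∀ w ∈ s, ∀ j, 1 ≤ j → j ≤ L → ¬ Cell (fun j => (j : ℤ) ^ 2) 1 (e w) (m w) (δ w) (rin w) (rout w) j → 4 ≤ j) :
    15 * datumOff (lawPow 3) 1 s e m δ rin rout q L ≤ 7 * datumOff (fun j => (j : ℤ) ^ 2) 1 s e m δ rin rout q L := by
  have h := datumOff_le_of_placewise (f := lawPow 3) (g := fun j => (j : ℤ) ^ 2) (den := 1) (den' := 1) (a := 15) (b := 7) (q := q)
    (e := e) (m := m) (δ := δ) (rin := rin) (rout := rout) one_pos one_pos hq (L := L)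
    (fun w hw => row_kappaThreeHalves_ratio_sharp (he w hw) (hm w hw) (δ w) (rin w) (rout w) L (h4 w hw))
  push_cast at h
  linarith

end Datum

/-- WORKED PLACE FREY `p = 7`, `l = 107` (`e 1605, m 210, δ 1604, r_in 268, r_out −4472, L = 53`): the floor-free form fires (`8·210 = 1680 ≤ 3·1604 + 4·4740
= 23772`), so `15·T_{3/2} ≤ 7·T_print` — here trivially, `T_{3/2} = 0` and `T_print = 40601` (part 3b `worked_offDemand`). [folklore] -/
theorem worked_kappaThreeHalves_sharp :
    15 * offDemand (lawPow 3) 1 1605 210 1604 268 (-4472) 53 ≤ 7 * offDemand (fun j => (j : ℤ) ^ 2) 1 1605 210 1604 268 (-4472) 53 :=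
  row_kappaThreeHalves_ratio_sharp_of_linear (by norm_num) (by norm_num) 1604 268 (-4472) 53 (by norm_num) (by norm_num)

end Summit.ABC.IUTFork.Repair.RH.ReqsideWeightLaws

end
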